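import Summits.CriticalPhenomena.PercolationContinuityZ3.Theorems.PercNearOneGluingNoHeavyLowerTailKnQuestion8CoefficientwiseTrivialCoreFlip
import HarnessLib

/-!
# Clusters of the root on a cycle: the two runs (NC* on cycles, part 1) — prim-lf-2 gen 65

Support file (`--supports stmt-CriticalPhenomena-4575`, closed), prover `prim-lf-2` (gen 65).  No definitions, no named facts, no sorries; standard axioms.
Memo `prim-lf-2/CW-NCA-gen63.md` §5 (NC* on every cycle, paper proof) and `prim-lf-2/CW-NCDOWN-gen65.md` §4.

A CYCLE through the root `x` is given explicitly (as in `cycle_twoRoutes` of `…CoreClassKernelMixCycleIET`): a closed vertex sequence `w 0 = x, w 1, …, w L = x`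
(`w` injective on `[0, L)`) and an edge sequence `e 1, …, e L` with `ends (e t) = s(w (t−1), w t)`; `E` is the set of these edges (`L = 2` is a digon — parallel
edges are allowed).  For a colouring `s ⊆ E` (red edges) the red cluster of `x` is `C_x(s) = openCluster (ends '' s) x`.
* `Coefficientwise.cycle_index_eq` — index bookkeeping: `w a = w b` with `a, b ≤ L` forces `a = b` or `{a, b} = {0, L}`.
* `Coefficientwise.cycle_openCluster_subset_runs` — every vertex of `C_x(s)` is some `w j`, `j ≤ L`, reached along a red clockwise PREFIX `e 1, …, e j` or a red
  counter-clockwise SUFFIX `e (j+1), …, e L`.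
* `Coefficientwise.cycle_mem_openCluster_iff` — **the two runs**: for `j ≤ L`, `w j ∈ C_x(s)` iff the prefix `e 1..e j` or the suffix `e (j+1)..e L` is red.
Part 2 (`…CoefficientwiseNCStarCycle.lean`) builds from these the dominating injection of memo §5 and proves NC*/NCA on every cycle.
[cite: KozmaNitzan2024, Questions 8–9 (§5.5 p. 36) (context: the Question-8 pocket covariance programme)]
-/

namespace Summit.CriticalPhenomena.PercolationContinuityZ3.Theorems

open Finset Literature.Probability.Percolation

namespace Coefficientwise

variable {ι V : Type*}

/-- Index bookkeeping on a closed vertex sequence `w 0 = w L` injective on `[0, L)`: `w a = w b` with `a, b ≤ L` forces `a = b` or `{a,b} = {0,L}`. [folklore] -/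
theorem cycle_index_eq (L : ℕ) (w : ℕ → V) (x : V) (hw0 : w 0 = x) (hwL : w L = x)
    (hwinj : ∀ i j, i < L → j < L → w i = w j → i = j) {a b : ℕ} (ha : a ≤ L) (hb : b ≤ L) (hab : w a = w b) :
    a = b ∨ (a = 0 ∧ b = L) ∨ (a = L ∧ b = 0) := by
  rcases Nat.lt_or_ge a L with haL | haL <;> rcases Nat.lt_or_ge b L with hbL | hbL
  · exact Or.inl (hwinj a b haL hbL hab)
  · have hb' : b = L := le_antisymm hb hbL
    by_cases hL0 : L = 0
    · left; omega
    · have h0 : w a = w 0 := by rw [hab, hb', hwL, hw0]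
      exact Or.inr (Or.inl ⟨hwinj a 0 haL (Nat.pos_of_ne_zero hL0) h0, hb'⟩)
  · have ha' : a = L := le_antisymm ha haL
    by_cases hL0 : L = 0
    · left; omega
    · have h0 : w 0 = w b := by rw [← hab, ha', hwL, hw0]
      exact Or.inr (Or.inr ⟨ha', (hwinj 0 b (Nat.pos_of_ne_zero hL0) hbL h0).symm⟩)
  · left; omega

/-- On an explicit cycle, every vertex of the red cluster of `x` for a colouring `s ⊆ E` is one of the `w j` (`j ≤ L`), reached along a red clockwise prefix
or a red counter-clockwise suffix. [cite: KozmaNitzan2024, §5.5 (context only; folklore)] -/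
theorem cycle_openCluster_subset_runs (ends : ι → Sym2 V) (L : ℕ) (w : ℕ → V) (e : ℕ → ι) (x : V) (E : Finset ι)
    (hw0 : w 0 = x) (hwL : w L = x) (hwinj : ∀ i j, i < L → j < L → w i = w j → i = j)
    (he : ∀ t, 1 ≤ t → t ≤ L → ends (e t) = s(w (t - 1), w t))
    (hE : ∀ i, i ∈ E ↔ ∃ t, 1 ≤ t ∧ t ≤ L ∧ e t = i)
    (s : Finset ι) (hs : s ⊆ E) :
    openCluster (ends '' (↑s : Set ι)) x ⊆
      {v | ∃ j, j ≤ L ∧ v = w j ∧ ((∀ t, 1 ≤ t → t ≤ j → e t ∈ s) ∨ (∀ t, j < t → t ≤ L → e t ∈ s))} := by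
  refine openCluster_subset_of_closed ends s x (S := {v | ∃ j, j ≤ L ∧ v = w j ∧
      ((∀ t, 1 ≤ t → t ≤ j → e t ∈ s) ∨ (∀ t, j < t → t ≤ L → e t ∈ s))}) ?_ ?_
  · exact ⟨0, Nat.zero_le _, hw0.symm, Or.inl (fun t h1 h0 => by omega)⟩
  · intro i hi a b hab ha
    obtain ⟨j, hjL, rfl, hrun⟩ := ha
    obtain ⟨t, ht1, htL, hti⟩ := (hE i).mp (hs hi)
    have hends : s(w (t - 1), w t) = s(w j, b) := by rw [← he t ht1 htL, hti, hab]
    rcases Sym2.eq_iff.mp hends with ⟨h1, h2⟩ | ⟨h1, h2⟩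
    · -- `w (t-1) = w j`, `b = w t`
      rcases cycle_index_eq L w x hw0 hwL hwinj (by omega) hjL h1 with hjt | ⟨ht0, hjL'⟩ | ⟨htL', _⟩
      · -- `j = t - 1`
        refine ⟨t, htL, h2.symm, ?_⟩
        rcases hrun with hpre | hsuf
        · left; intro t' h1' h2'
          by_cases htt : t' = t
          · rw [htt, hti]; exact hi
          · exact hpre t' h1' (by omega)
        · right; intro t' h1' h2'
          exact hsuf t' (by omega) h2'
      · -- `t = 1`, `j = L`: `b = w 1`, reached by the prefix `e 1`
        refine ⟨t, htL, h2.symm, Or.inl ?_⟩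
        intro t' h1' h2'
        have : t' = t := by omega
        rw [this, hti]; exact hi
      · exfalso; omega
    · -- `w t = w j`, `b = w (t-1)`
      rcases cycle_index_eq L w x hw0 hwL hwinj htL hjL h2 with hjt | ⟨ht0, _⟩ | ⟨htL', hj0⟩
      · -- `j = t`
        refine ⟨t - 1, by omega, h1.symm, ?_⟩
        rcases hrun with hpre | hsuf
        · left; intro t' h1' h2'
          exact hpre t' h1' (by omega)
        · right; intro t' h1' h2'
          by_cases htt : t' = t
          · rw [htt, hti]; exact hi
          · exact hsuf t' (by omega) h2'
      · exfalso; omega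
      · -- `t = L`, `j = 0`: `b = w (L-1)`, reached by the suffix `e L`
        refine ⟨t - 1, by omega, h1.symm, Or.inr ?_⟩
        intro t' h1' h2'
        have : t' = t := by omega
        rw [this, hti]; exact hi

/-- **The two runs.**  On an explicit cycle, for `s ⊆ E` and `j ≤ L`: `w j ∈ C_x(s)` iff the clockwise prefix `e 1, …, e j` is red or the counter-clockwise
suffix `e (j+1), …, e L` is red. [cite: KozmaNitzan2024, §5.5 (context only; folklore)] -/
theorem cycle_mem_openCluster_iff (ends : ι → Sym2 V) (L : ℕ) (w : ℕ → V) (e : ℕ → ι) (x : V) (E : Finset ι)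
    (hw0 : w 0 = x) (hwL : w L = x) (hwinj : ∀ i j, i < L → j < L → w i = w j → i = j)
    (he : ∀ t, 1 ≤ t → t ≤ L → ends (e t) = s(w (t - 1), w t))
    (hE : ∀ i, i ∈ E ↔ ∃ t, 1 ≤ t ∧ t ≤ L ∧ e t = i)
    (s : Finset ι) (hs : s ⊆ E) {j : ℕ} (hj : j ≤ L) :
    w j ∈ openCluster (ends '' (↑s : Set ι)) x ↔
      ((∀ t, 1 ≤ t → t ≤ j → e t ∈ s) ∨ (∀ t, j < t → t ≤ L → e t ∈ s)) := by
  constructor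
  · intro hmem
    obtain ⟨j', hj'L, hjj', hrun⟩ := cycle_openCluster_subset_runs ends L w e x E hw0 hwL hwinj he hE s hs hmem
    rcases cycle_index_eq L w x hw0 hwL hwinj hj hj'L hjj' with rfl | ⟨hj0, _⟩ | ⟨hjL', _⟩
    · exact hrun
    · left; intro t h1 h2; omega
    · right; intro t h1 h2; omega
  · -- explicit red walks along the prefix / the suffix
    have step : ∀ t, 1 ≤ t → t ≤ L → e t ∈ s →
        (w (t - 1) ∈ openCluster (ends '' (↑s : Set ι)) x ↔ w t ∈ openCluster (ends '' (↑s : Set ι)) x) := by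
      intro t h1 h2 het
      constructor
      · intro h; exact mem_openCluster_of_edge ends het (he t h1 h2) h
      · intro h; exact mem_openCluster_of_edge ends het (by rw [he t h1 h2, Sym2.eq_swap]) h
    rintro (hpre | hsuf)
    · -- induction along the prefix
      have key : ∀ k, k ≤ j → w k ∈ openCluster (ends '' (↑s : Set ι)) x := by
        intro k
        induction k with
        | zero => intro _; rw [hw0]; exact mem_openCluster_self _ x
        | succ k ih =>
          intro hk
          have hk' := ih (by omega)
          have := (step (k + 1) (by omega) (by omega) (hpre (k + 1) (by omega) hk)).mp
          simp only [Nat.add_sub_cancel] at this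
          exact this hk'
      exact key j le_rfl
    · -- induction along the suffix, downwards from `w L = x`
      have key : ∀ d k, k + d = L → j ≤ k → w k ∈ openCluster (ends '' (↑s : Set ι)) x := by
        intro d
        induction d with
        | zero => intro k hk _; rw [Nat.add_zero] at hk; rw [hk, hwL]; exact mem_openCluster_self _ x
        | succ d ih =>
          intro k hk hjk
          have hk1 := ih (k + 1) (by omega) (by omega)
          have := (step (k + 1) (by omega) (by omega) (hsuf (k + 1) (by omega) (by omega))).mpr hk1
          simp only [Nat.add_sub_cancel] at this
          exact this
      exact key (L - j) j (by omega) le_rfl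

end Coefficientwise

end Summit.CriticalPhenomena.PercolationContinuityZ3.Theorems
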